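import Literature.AlgebraicGeometry.Frobenioids.PadicFrobenioidBaseGaloisSystemCoset
import Literature.AlgebraicGeometry.Frobenioids.PadicFrobenioidFieldUnitsEquivariance
import HarnessLib

/-!
# Frobenioids II, Thm. 2.4 (ii): "`Ψ` induces a pair of compatible isomorphisms `G₁ ⥲ G₂`; `K̄₁^× ⥲ K̄₂^×`"

Mochizuki, *The geometry of Frobenioids II*, Kyushu J. Math. **62** (2008) 401–460, §2, proof of Theorem 2.4 (ii),
author's text p. 20 l.−5 – p. 21 l. 6 [cite: MochizukiFrdII2008, Thm 2.4 (ii) p.20]: "Then since `Φᵢ` is fieldwise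
saturated, it follows — by varying the objects `Aᵢ` and reconstructing the multiplicative group associated to the
field determined by the image of `Aᵢ` … as the groupification of the monoid `O^▷(Aᵢ)` — that `Ψ` induces a pair of
compatible isomorphisms `G₁ ⥲ G₂`; `K̄₁^× ⥲ K̄₂^×` — where this pair is well-defined up to composition with
automorphisms of the pair `(G₂, K̄₂^×)` induced by elements of `G₂`."

PROOF-ONLY ASSEMBLY (cell abc-iut, `plan/L1/SUBDAG-FrdII-Thm24.md` row W12-L17 `PairIso`): abc-iut-w5-d188's
Frobenioid side (`PadicFrd.exists_fieldUnits_colimit_iso_equivariant`, p417835: for fieldwise saturated `Φ₁`, `Φ₂`, the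
base equivalence `E = Ψ^Base` and the slot `ΨB : B₁ ≅ E^op ⋙ B₂`, the direct limits `lim→ K_{1,A_j}^×`, `lim→ K_{2,Ψ A_j}^×`
along ANY system `c` are isomorphic, equivariantly for every endomorphism `σ` of `c`) + the base-structure side on the
small model `CosetCat Π` (GAP row G-w5d188-1: `toAutCosetMulEquiv : Π ≃* Aut (cosetSystem N hN)`, straightening
`exists_iso_cosetSystem`), giving:

* `nonempty_mulEquiv_of_cosetCat_equivalence` — `Ψ^Base : CosetCat Π₁ ≌ CosetCat Π₂` induces `Π₁ ≃* Π₂`;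
* `exists_mulEquiv_compatible_of_cosetCat_equivalence` — such a `φ` together with a straightening
  `ι : cosetSystem N₁ ⋙ E.op ≅ cosetSystem N₂` under which `Ψ^Base(r_g) = r_{φ g}` (the "up to elements of `G₂`" is `ι`);
* `exists_pairIso` — **the printed pair**: `φ : Π₁ ≃* Π₂` and `e : K̄₁^× ≅ K̄₂^×` (direct limits of `B₀|_D = K^×` along the
  universal coverings) with `e ∘ g = φ(g) ∘ e` for every `g ∈ Π₁`.
Theorems only; no new definitions; nothing here bears on [IUTchIII] Cor. 3.12.
-/

noncomputable section

namespace Literature.AlgebraicGeometry.Frobenioids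

open CategoryTheory CategoryTheory.Limits Opposite Topology Filter
open Literature.AnabelianGeometry.SemiGraphs

universe v₃ u₃ u

namespace BaseGaloisSystem

/-! ### Transport of direct limits along an isomorphism of systems (general target) -/

section Generic

variable {J : Type*} [Category J] {K : Type*} [Category K] {C : Type u₃} [Category.{v₃} C]

/-- Transport of colimits along an isomorphism of systems is equivariant for `Iso.conjAut` (general form of the
lemma of `PadicFrobenioidBaseGaloisSystemIndependence`). [cite: MochizukiFrdII2008, Thm 2.4 (ii) p.21] -/
theorem colimit_isoOfNatIso_conjAut' {c c' : J ⥤ K} (ι : c ≅ c') (F : K ⥤ C) [HasColimit (c ⋙ F)] [HasColimit (c' ⋙ F)]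
    (σ : Aut c) :
    (HasColimit.isoOfNatIso (Functor.isoWhiskerRight ι F)).hom ≫ colimMap (Functor.whiskerRight (ι.conjAut σ).hom F) =
      colimMap (Functor.whiskerRight σ.hom F) ≫ (HasColimit.isoOfNatIso (Functor.isoWhiskerRight ι F)).hom := by
  have key : (Functor.isoWhiskerRight ι F).hom ≫ Functor.whiskerRight (ι.conjAut σ).hom F =
      Functor.whiskerRight σ.hom F ≫ (Functor.isoWhiskerRight ι F).hom := by
    rw [Functor.isoWhiskerRight_hom, Iso.conjAut_hom, Iso.conj_apply, ← Functor.whiskerRight_comp,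
      ← Functor.whiskerRight_comp, Iso.hom_inv_id_assoc]
  apply colimit.hom_ext
  intro j
  rw [HasColimit.isoOfNatIso_ι_hom_assoc, ι_colimMap, ι_colimMap_assoc, HasColimit.isoOfNatIso_ι_hom,
    ← NatTrans.comp_app_assoc, ← NatTrans.comp_app_assoc, key]

end Generic

/-! ### `Ψ^Base` induces `Π₁ ≃* Π₂`, compatibly on deck transformations -/

variable {G : Type u} [Group G] [TopologicalSpace G] (hG : IsTempered G)
  {G₂ : Type u} [Group G₂] [TopologicalSpace G₂] [IsTopologicalGroup G₂] (hG₂ : IsTempered G₂)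
  (N : ℕ → OpenNormalSubgroup G) (hN : Antitone N)

include hG hG₂ in
/-- **Compatibility of the induced `Π₁ ≃* Π₂` with `Ψ^Base` on deck transformations.**  For an equivalence
`E = Ψ^Base : CosetCat Π₁ ≌ CosetCat Π₂` there are a straightening `ι : cosetSystem N ⋙ E.functor.op ≅ cosetSystem N₂`
(some cofinal antitone `N₂`) and `φ : Π₁ ≃* Π₂` such that, for every `g ∈ Π₁`, right translation by `φ g` on the
`Π₂`-system IS `Ψ^Base` of right translation by `g`, conjugated by `ι` — `φ` is "induced by `Ψ`", the printed
"well-defined up to … automorphisms … induced by elements of `G₂`" being the choice of `ι`.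
[cite: MochizukiFrdII2008, Thm 2.4 (ii) p.21] -/
theorem exists_mulEquiv_compatible_of_cosetCat_equivalence (E : CosetCat G ≌ CosetCat G₂)
    (hNb : ∀ U ∈ 𝓝 (1 : G), ∃ k, (N k : Set G) ⊆ U) :
    ∃ (N₂ : ℕ → OpenNormalSubgroup G₂) (hN₂ : Antitone N₂) (_ : ∀ U ∈ 𝓝 (1 : G₂), ∃ k, (N₂ k : Set G₂) ⊆ U)
      (ι : cosetSystem N hN ⋙ E.functor.op ≅ cosetSystem N₂ hN₂) (φ : G ≃* G₂),
      ∀ g : G, toAutCoset N₂ hN₂ (φ g) =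
        ι.conjAut ((Equivalence.congrRight (E := ℕ) E.op).functor.mapIso (toAutCoset N hN g)) := by
  obtain ⟨N₂, hN₂, hN₂b, ⟨ι⟩⟩ := exists_iso_cosetSystem hG₂ (cosetSystem N hN ⋙ E.functor.op)
    (fun k => torsor_functor_obj E (cosetSystem_torsor N hN k)) (cofinal_comp_equivalence E _ (cosetSystem_cofinal N hN hNb))
  let e₂ : Aut (cosetSystem N hN) ≃* Aut (cosetSystem N hN ⋙ E.functor.op) :=
    (Equivalence.congrRight (E := ℕ) E.op).fullyFaithfulFunctor.autMulEquivOfFullyFaithful (cosetSystem N hN)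
  refine ⟨N₂, hN₂, hN₂b, ι, (toAutCosetMulEquiv N hN hG hNb).trans
    ((e₂.trans ι.conjAut).trans (toAutCosetMulEquiv N₂ hN₂ hG₂ hN₂b).symm), fun g => ?_⟩
  change toAutCosetMulEquiv N₂ hN₂ hG₂ hN₂b ((toAutCosetMulEquiv N₂ hN₂ hG₂ hN₂b).symm
    (ι.conjAut (e₂ (toAutCosetMulEquiv N hN hG hNb g)))) = _
  rw [MulEquiv.apply_symm_apply]
  rfl

include hG hG₂ in
/-- **[FrdII] Thm. 2.4 (ii), "`Ψ` induces `G₁ ⥲ G₂`"** on the small base: an equivalence `CosetCat Π₁ ≌ CosetCat Π₂` of the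
bases of two tempered groups (`Π₁` Galois-countable) yields `Π₁ ≃* Π₂`. [cite: MochizukiFrdII2008, Thm 2.4 (ii) p.21] -/
theorem nonempty_mulEquiv_of_cosetCat_equivalence [IsTopologicalGroup G] [SecondCountableTopology G]
    (E : CosetCat G ≌ CosetCat G₂) :
    Nonempty (G ≃* G₂) := by
  obtain ⟨N, hN, hNb⟩ := exists_antitone_cofinal_seq hG
  obtain ⟨-, -, -, -, φ, -⟩ := exists_mulEquiv_compatible_of_cosetCat_equivalence hG hG₂ N hN E hNb
  exact ⟨φ⟩

/-! ### The printed pair `(G₁ ⥲ G₂, K̄₁^× ⥲ K̄₂^×)` -/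

section Pair

variable {p₁ p₂ : ℕ} [Fact p₁.Prime] [Fact p₂.Prime]
  (d₁ : PadicFrd.Datum (CosetCat G) p₁) (d₂ : PadicFrd.Datum (CosetCat G₂) p₂)

include hG hG₂ in
/-- **[FrdII] Thm. 2.4 (ii), the compatible pair.**  For FIELDWISE SATURATED `p`-adic Frobenioid data over the small
bases `CosetCat Π₁`, `CosetCat Π₂`, an equivalence of bases `E = Ψ^Base` with the slot `ΨB : B₁ ≅ E^op ⋙ B₂` ([FrdII] row
L02, displayed hypothesis as in p417835), and a cofinal antitone sequence `N` of open normal subgroups of `Π₁` (the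
universal covering `(Π₁/N_k)_k`): there are `φ : Π₁ ≃* Π₂`, a cofinal antitone `N₂` for `Π₂`, and an isomorphism
`e : lim→_k K_{1,Π₁/N_k}^× ≅ lim→_k K_{2,Π₂/N₂,k}^×` ("`K̄₁^× ⥲ K̄₂^×`", direct limits of `B₀|_D`) which is
`φ`-EQUIVARIANT: `e ∘ (g·) = (φ g ·) ∘ e` for every `g ∈ Π₁` — "a pair of compatible isomorphisms `G₁ ⥲ G₂`;
`K̄₁^× ⥲ K̄₂^×` … well-defined up to … elements of `G₂`" (the choice of the straightening).
[cite: MochizukiFrdII2008, Thm 2.4 (ii) p.21] -/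
theorem exists_pairIso (hfs₁ : d₁.IsFieldwiseSaturated) (hfs₂ : d₂.IsFieldwiseSaturated)
    (E : CosetCat G ≌ CosetCat G₂) (ΨB : d₁.B ≅ E.functor.op ⋙ d₂.B)
    (hNb : ∀ U ∈ 𝓝 (1 : G), ∃ k, (N k : Set G) ⊆ U)
    [HasColimit (cosetSystem N hN ⋙ d₁.B)] [HasColimit (cosetSystem N hN ⋙ PadicFrd.bZeroOn d₁.base)]
    [HasColimit ((cosetSystem N hN ⋙ E.functor.op) ⋙ d₂.B)]
    [HasColimit ((cosetSystem N hN ⋙ E.functor.op) ⋙ PadicFrd.bZeroOn d₂.base)]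
    (hB₂ : ∀ (N₂ : ℕ → OpenNormalSubgroup G₂) (hN₂ : Antitone N₂),
      HasColimit (cosetSystem N₂ hN₂ ⋙ PadicFrd.bZeroOn d₂.base)) :
    ∃ (φ : G ≃* G₂) (N₂ : ℕ → OpenNormalSubgroup G₂) (hN₂ : Antitone N₂)
      (_ : ∀ U ∈ 𝓝 (1 : G₂), ∃ k, (N₂ k : Set G₂) ⊆ U)
      (e : colimit (cosetSystem N hN ⋙ PadicFrd.bZeroOn d₁.base) ≅
        @colimit _ _ _ _ (cosetSystem N₂ hN₂ ⋙ PadicFrd.bZeroOn d₂.base) (hB₂ N₂ hN₂)),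
      ∀ g : G, e.hom ≫ @colimMap _ _ _ _ _ _ (hB₂ N₂ hN₂) (hB₂ N₂ hN₂)
          (Functor.whiskerRight (toAutCoset N₂ hN₂ (φ g)).hom (PadicFrd.bZeroOn d₂.base)) =
        colimMap (Functor.whiskerRight (toAutCoset N hN g).hom (PadicFrd.bZeroOn d₁.base)) ≫ e.hom := by
  -- Frobenioid side (p417835): along the universal covering of `Π₁`, equivariant for every endomorphism
  obtain ⟨e₁, he₁⟩ := PadicFrd.exists_fieldUnits_colimit_iso_equivariant d₁ d₂ hfs₁ hfs₂ E ΨB (cosetSystem N hN)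
  -- base side: straighten the image system and read off `φ`
  obtain ⟨N₂, hN₂, hN₂b, ι, φ, hφ⟩ := exists_mulEquiv_compatible_of_cosetCat_equivalence hG hG₂ N hN E hNb
  haveI := hB₂ N₂ hN₂
  let e₂ : colimit ((cosetSystem N hN ⋙ E.functor.op) ⋙ PadicFrd.bZeroOn d₂.base) ≅
      colimit (cosetSystem N₂ hN₂ ⋙ PadicFrd.bZeroOn d₂.base) :=
    HasColimit.isoOfNatIso (Functor.isoWhiskerRight ι (PadicFrd.bZeroOn d₂.base))
  refine ⟨φ, N₂, hN₂, hN₂b, e₁ ≪≫ e₂, fun g => ?_⟩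
  have h₂ := colimit_isoOfNatIso_conjAut' ι (PadicFrd.bZeroOn d₂.base)
    ((Equivalence.congrRight (E := ℕ) E.op).functor.mapIso (toAutCoset N hN g))
  rw [← hφ g] at h₂
  rw [Iso.trans_hom, Category.assoc, h₂, ← Category.assoc, ← Category.assoc]
  congr 1
  exact he₁ (toAutCoset N hN g).hom

end Pair

end BaseGaloisSystem

end Literature.AlgebraicGeometry.Frobenioids

end
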